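import Summits.ABC.ABC.Theorems.TowerFourSubLiouville.Negative.HallLangTransferTridentPell

/-!
# `TowerFourSubLiouville` (stmt-ABC-1649): the `ABC` half-plane of the two-exponent diagram, and the
strategist's moving-target ladder sandwiched

Negative-side module of the standing disprover (cycle 11, refuter-cdisprove-stmt-ABC-1649-g11-0, 2026-08-17),
companion of `Negative.TwoExponentDiagram` (p126734/p126869), `Negative.HallLangTransferTridentPell` (p133548: the
five FALSE corners `(8/3,0)`, `(2,1)`, `(1,3/2)`, `(0,2)`) and `Negative.Framing` (p74157: `ABC ⟹ crux`).

The open core of the crux is the diagonal `θ = φ = η` of the two-exponent uniform binomial quartic saving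
`UBQ₂(θ, φ)`: `∃ Z₀ ∀ v w Y Z ≥ Z₀` (positive, `gcd(vY, wZ) = 1`, `wZ⁴ ≠ vY⁴`): `max(v,w) ≤ Z^θ ⟹ |wZ⁴ − vY⁴| > Z^φ`
(crux ⟺ `∃ η > 0, UBQ₂(η, η)`, p87895 + p86153).  The diagram's docstring asserts, without proof in the tree,
that `ABC` makes the whole half-plane `(9/4)θ + φ < 2` TRUE.  This file proves it:

* `ubq₂_of_abc`: **`ABC ⟹ UBQ₂(θ, φ)` for all `θ ≥ 0`, `(9/4)θ + φ < 2`.**  Proof: an enemy `a + vY⁴ = wZ⁴` (either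
  order) is an abc triple with `c ≥ Z⁴` and `rad(abc) ≤ a·v·w·Y·Z ≤ Z^φ · Z^{2θ} · 2^{1/4}Z^{1+θ/4} · Z`, so `abc` at
  `δ = s/16`, `s := 2 − (9/4)θ − φ > 0`, gives `Z^{16} < K⁴·2^{1+δ}·Z^{16−3s}` (`abc_enemy_numerics`), false for large `Z`.
  Corollaries: the diagonal `ubq_of_abc` (`ABC ⟹ UBQ η` for every `0 ≤ η < 8/13`), and the two rungs of the
  strategist's ladder (`Cruxes/TowerFourSubLiouville/StrategistSketch.lean`, 2026-08-17, which types
  `UniformMovingRoth4 ⟹ UniformMovingThue4 ⟹ crux`): `uniformMovingRoth4_of_abc` (budget `η(ε) = ε/5`; any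
  `η < 4ε/9` works) and `uniformMovingThue4_of_abc` (budget `η(ε) = (1+ε)/3`; any `η < 4(1+ε)/9`), matrices verbatim.
  **So the ladder is sandwiched `ABC ⟹ S⁺3 ⟹ S⁺2 ⟹ UBQ ⟹ crux`: no rung is refutable short of `¬ABC`** — the same
  status as every other typed strengthening on this crux (`HallLang1728`/`UniformLjunggren`, p131908/p132209;
  Lang–Waldschmidt₄, p111401; `UniformSadicTowerFour`, support 15070).
* Unconditional calibration of the ladder from the landed corners (`movingRoth4_budget_le_one`, `_le_two`,
  `movingThue4_budget_le`, `movingRoth4_false_without_pos_eps`, `not_uniformMovingRoth4_forall_eta`,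
  `not_uniformMovingThue4_forall_eta`): a Roth-rung witness has `η(ε) ≤ 1` for `ε < 1/2` and `≤ 2` for `ε < 1`, a
  Thue-rung witness `η(ε) ≤ 8/3`; the hypothesis `0 < ε` of the Roth rung is load-bearing (saving beyond `Z²` fails for
  every `η > 0`); and neither rung survives `∃ η ↦ ∀ η`.  Random model: `η < ε` (Roth), `η < 1 + ε` (Thue).

The picture of the `(θ, φ)` plane after this file (P = proved here under `ABC`; F = landed FALSE corners; between the
`ABC` line `(9/4)θ + φ = 2` and the corners only the random-model boundary `θ + φ = 2` is conjectured):
```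
  φ
  2 ●(0,2)━━━━━━━━━━━━━━━━━━━━━━━━━━━━━━   F above φ = 2 for every θ > 0
    │P╲         ●(1,3/2)━━━━━━━━━━━━━━━━━   F
  1 │P  ╲ (9/4)θ+φ=2      ●(2,1)━━━━━━━━━   F
    │P    ╲   (ABC ⟹ TRUE, this file)
  0 ┼P──────●(8/9,0)············●(8/3,0)━   F (torus corner)
    0                1        2     8/3   θ
```
Symmetric tight identity shapes (the source of all four ℙ¹/torus corners) were censused this cycle beyond the landed
ones — `Cruxes/TowerFourSubLiouville/Disproof.lean` § Cycle 11 (seat-local exact arithmetic; kit jobs j021711, j021837):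
the `s ↦ −s` symmetric Belyi identities `Q(s)P(s)⁴ ∓ Q(−s)P(−s)⁴ = a(s)` (`deg P = z`, `deg Q = d`,
`deg a = 2z + 1 − d`; corner `(d/z, (2z+1−d)/z)`) are `[z/z]` Padé approximants of `(A(x)/A(−x))^{1/4}`, `deg A = d`,
over-convergent by `d − 1` odd orders.  For `d = 2` the moduli polynomial `D_z(q)` is `4q − 5`, `20q − 21` (`z = 1, 2`:
`padeFamily₁`, `padeFamily₂`) and then of degree `3, 3, 6, 6` (`z = 3, …, 6`) WITHOUT rational roots: the corners
`(2/z, 2 − 1/z) → (0, 2)` along `φ = 2 − θ/2` are not supplied by identities of this kind; for `3 ≤ d ≤ 7`, `z ≤ 6`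
every real symmetric solution found is irrational (e.g. `(2;5,0)`, `(3;3,4)`, `(3;5,2)`, `(4;5,4)`, `(5;5,6)`), the
rational ones being exactly the Padé-for-free `z = 1` shapes (`bezoutFamily₃ = (1;3,0)`).  So no new corner, and in
particular no symmetric identity lowers the uniform ceiling `3/2` (shapes `(4;4,5)`, `(4;5,4)`, `(5;5,6)`, `(5;4,7)`,
`(6;5,8)`, `(6;6,7)` would give `5/4, 5/4, 6/5, 7/5, 4/3, 7/6`).
-/

-- `Summit.ABC.ABC` is the mandated summit-side namespace (CONVENTIONS §2); the duplicate is deliberate.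
set_option linter.dupNamespace false

namespace Summit.ABC.ABC.Theorems.TowerFourSubLiouville.Negative

open Literature.NumberTheory.DiophantineGeometry (IsABCTriple rad rad_def)

/-! ## The two-exponent uniform saving `UBQ₂ θ φ` and the `ABC`-true half-plane `(9/4)θ + φ < 2` -/

/-- The radical of a binomial-quartic triple divides `a · vY · wZ`. -/
theorem rad_binomial_dvd (a v w Y Z : ℕ) :
    rad a (v * Y ^ 4) (w * Z ^ 4) ∣ a * (v * Y) * (w * Z) := by
  rw [rad_def]
  have h4 : ∀ u T : ℕ, UniqueFactorizationMonoid.radical (u * T ^ 4) ∣ u * T := fun u T =>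
    calc UniqueFactorizationMonoid.radical (u * T ^ 4)
        ∣ UniqueFactorizationMonoid.radical u * UniqueFactorizationMonoid.radical (T ^ 4) :=
          UniqueFactorizationMonoid.radical_mul_dvd
      _ ∣ u * T := mul_dvd_mul UniqueFactorizationMonoid.radical_dvd_self
          (UniqueFactorizationMonoid.radical_pow_dvd.trans UniqueFactorizationMonoid.radical_dvd_self)
  calc UniqueFactorizationMonoid.radical (a * (v * Y ^ 4) * (w * Z ^ 4))
      ∣ UniqueFactorizationMonoid.radical (a * (v * Y ^ 4)) *
          UniqueFactorizationMonoid.radical (w * Z ^ 4) := UniqueFactorizationMonoid.radical_mul_dvd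
    _ ∣ (UniqueFactorizationMonoid.radical a * UniqueFactorizationMonoid.radical (v * Y ^ 4)) *
          UniqueFactorizationMonoid.radical (w * Z ^ 4) :=
        mul_dvd_mul_right UniqueFactorizationMonoid.radical_mul_dvd _
    _ ∣ a * (v * Y) * (w * Z) :=
        mul_dvd_mul (mul_dvd_mul UniqueFactorizationMonoid.radical_dvd_self (h4 v Y)) (h4 w Z)

/-- The same radical with the summands in the other order. -/
theorem rad_binomial_dvd' (a v w Y Z : ℕ) :
    rad (v * Y ^ 4) a (w * Z ^ 4) ∣ a * (v * Y) * (w * Z) := by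
  have h := rad_binomial_dvd a v w Y Z
  rw [rad_def] at h ⊢
  rwa [mul_comm (v * Y ^ 4) a]

/-- `gcd(vY, wZ) = 1 ⟹ gcd(vY⁴, wZ⁴) = 1`. -/
theorem coprime_binomial {v w Y Z : ℕ} (h : Nat.Coprime (v * Y) (w * Z)) :
    Nat.Coprime (v * Y ^ 4) (w * Z ^ 4) := by
  have h4 : Nat.Coprime ((v * Y) ^ 4) ((w * Z) ^ 4) := Nat.Coprime.pow 4 4 h
  refine Nat.Coprime.coprime_dvd_left ?_ (Nat.Coprime.coprime_dvd_right ?_ h4)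
  · exact ⟨v ^ 3, by ring⟩
  · exact ⟨w ^ 3, by ring⟩

/-- Real-exponent bookkeeping: the key numerical inequality behind `ubq₂_of_abc`.  From the `ABC` bound
`c < K · R^{1+δ}` with `Z⁴ ≤ c`, `R ≤ a·v·w·Y·Z`, `a ≤ Z^φ`, `v, w ≤ Z^θ`, `Y⁴ ≤ 2 Z^{θ+4}` and
`δ = s/16`, `s = 2 − (9/4)θ − φ > 0`, one gets `Z^16 < K⁴ · 2^{1+δ} · Z^{16 − 3s}`. -/
theorem abc_enemy_numerics {K δ s θ φ a v w Y Z R c : ℝ} (hK : 0 < K) (hs : 0 < s) (hδ : δ = s / 16)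
    (hsdef : s = 2 - 9 / 4 * θ - φ) (hZ : 1 ≤ Z) (ha : 0 ≤ a) (hv : 0 ≤ v) (hw : 0 ≤ w)
    (hR : 0 ≤ R) (hRle : R ≤ a * v * w * Y * Z) (hc : Z ^ (4:ℕ) ≤ c) (habc : c < K * R ^ (1 + δ))
    (haφ : a ≤ Z ^ φ) (hvθ : v ≤ Z ^ θ) (hwθ : w ≤ Z ^ θ) (hY4 : Y ^ (4:ℕ) ≤ 2 * Z ^ (θ + 4)) :
    Z ^ (16:ℝ) < K ^ (4:ℕ) * (2:ℝ) ^ (1 + δ) * Z ^ (16 - 3 * s) := by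
  have hZ0 : 0 < Z := by linarith
  have hδ0 : 0 < δ := by rw [hδ]; linarith
  -- the product bound, to the fourth power: (a v w Y Z)^4 ≤ 2 Z^{16 - 4 s}
  have hP : (a * v * w * Y * Z) ^ (4:ℕ) ≤ 2 * Z ^ (16 - 4 * s) := by
    have h1 : (a * v * w * Y * Z) ^ (4:ℕ) = a ^ (4:ℕ) * v ^ (4:ℕ) * w ^ (4:ℕ) * Y ^ (4:ℕ) * Z ^ (4:ℕ) := by
      ring
    have ha4 : a ^ (4:ℕ) ≤ (Z ^ φ) ^ (4:ℕ) := pow_le_pow_left₀ ha haφ 4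
    have hv4 : v ^ (4:ℕ) ≤ (Z ^ θ) ^ (4:ℕ) := pow_le_pow_left₀ hv hvθ 4
    have hw4 : w ^ (4:ℕ) ≤ (Z ^ θ) ^ (4:ℕ) := pow_le_pow_left₀ hw hwθ 4
    have eφ : (Z ^ φ) ^ (4:ℕ) = Z ^ (4 * φ) := by
      rw [← Real.rpow_natCast, ← Real.rpow_mul hZ0.le]; norm_num; ring_nf
    have eθ : (Z ^ θ) ^ (4:ℕ) = Z ^ (4 * θ) := by
      rw [← Real.rpow_natCast, ← Real.rpow_mul hZ0.le]; norm_num; ring_nf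
    have e4 : Z ^ (4:ℕ) = Z ^ (4:ℝ) := by rw [← Real.rpow_natCast]; norm_num
    rw [h1]
    calc a ^ (4:ℕ) * v ^ (4:ℕ) * w ^ (4:ℕ) * Y ^ (4:ℕ) * Z ^ (4:ℕ)
        ≤ Z ^ (4 * φ) * Z ^ (4 * θ) * Z ^ (4 * θ) * (2 * Z ^ (θ + 4)) * Z ^ (4:ℝ) := by
          rw [← eφ, ← eθ, ← e4]
          have : 0 ≤ (Z ^ φ) ^ (4:ℕ) := by positivity
          have : 0 ≤ (Z ^ θ) ^ (4:ℕ) := by positivity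
          gcongr
      _ = 2 * (Z ^ (4 * φ) * Z ^ (4 * θ) * Z ^ (4 * θ) * Z ^ (θ + 4) * Z ^ (4:ℝ)) := by ring
      _ = 2 * Z ^ (16 - 4 * s) := by
          rw [← Real.rpow_add hZ0, ← Real.rpow_add hZ0, ← Real.rpow_add hZ0, ← Real.rpow_add hZ0]
          congr 1; congr 1; rw [hsdef]; ring
  -- raise the abc inequality to the fourth power
  have hc0 : 0 < c := lt_of_lt_of_le (by positivity) hc
  have hKR : 0 ≤ K * R ^ (1 + δ) := by positivity
  have h4 : c ^ (4:ℕ) < (K * R ^ (1 + δ)) ^ (4:ℕ) := pow_lt_pow_left₀ habc hc0.le (by norm_num)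
  have hZ16 : Z ^ (16:ℝ) ≤ c ^ (4:ℕ) := by
    have : Z ^ (16:ℝ) = (Z ^ (4:ℕ)) ^ (4:ℕ) := by
      rw [← Real.rpow_natCast, ← Real.rpow_natCast, ← Real.rpow_mul hZ0.le]; norm_num
    rw [this]; exact pow_le_pow_left₀ (by positivity) hc 4
  -- (K R^{1+δ})^4 = K^4 (R^4)^{1+δ} ≤ K^4 (2 Z^{16-4s})^{1+δ} = K^4 2^{1+δ} Z^{(16-4s)(1+δ)} ≤ K^4 2^{1+δ} Z^{16-3s}
  have hR4 : R ^ (4:ℕ) ≤ 2 * Z ^ (16 - 4 * s) := le_trans (pow_le_pow_left₀ hR hRle 4) hP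
  have step1 : (K * R ^ (1 + δ)) ^ (4:ℕ) = K ^ (4:ℕ) * (R ^ (4:ℕ)) ^ (1 + δ) := by
    rw [mul_pow]
    congr 1
    rw [← Real.rpow_natCast (R ^ (1 + δ)), ← Real.rpow_mul hR, ← Real.rpow_natCast R,
      ← Real.rpow_mul hR]
    norm_num; ring_nf
  have step2 : (R ^ (4:ℕ)) ^ (1 + δ) ≤ (2 * Z ^ (16 - 4 * s)) ^ (1 + δ) :=
    Real.rpow_le_rpow (by positivity) hR4 (by linarith)
  have step3 : (2 * Z ^ (16 - 4 * s)) ^ (1 + δ) = (2:ℝ) ^ (1 + δ) * Z ^ ((16 - 4 * s) * (1 + δ)) := by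
    rw [Real.mul_rpow (by norm_num) (by positivity), ← Real.rpow_mul hZ0.le]
  have step4 : Z ^ ((16 - 4 * s) * (1 + δ)) ≤ Z ^ (16 - 3 * s) := by
    apply Real.rpow_le_rpow_of_exponent_le hZ
    rw [hδ]; nlinarith
  calc Z ^ (16:ℝ) ≤ c ^ (4:ℕ) := hZ16
    _ < (K * R ^ (1 + δ)) ^ (4:ℕ) := h4
    _ = K ^ (4:ℕ) * (R ^ (4:ℕ)) ^ (1 + δ) := step1
    _ ≤ K ^ (4:ℕ) * ((2:ℝ) ^ (1 + δ) * Z ^ ((16 - 4 * s) * (1 + δ))) := by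
        rw [← step3]; exact mul_le_mul_of_nonneg_left step2 (by positivity)
    _ ≤ K ^ (4:ℕ) * ((2:ℝ) ^ (1 + δ) * Z ^ (16 - 3 * s)) := by
        apply mul_le_mul_of_nonneg_left _ (by positivity)
        exact mul_le_mul_of_nonneg_left step4 (by positivity)
    _ = K ^ (4:ℕ) * (2:ℝ) ^ (1 + δ) * Z ^ (16 - 3 * s) := by ring

/-- **`ABC ⟹ UBQ₂ θ φ` on the whole half-plane `(9/4)θ + φ < 2`, `θ ≥ 0`** — the conditional (TRUE) side
of the two-exponent diagram of `Negative.TwoExponentDiagram`, whose docstring states it (from the skeleton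
lemma `AbcGivesUBQ` of the dead line `fourth-radical-binomial-thue`, diagonal case) without proof.
Consequently NO point of that half-plane can carry an enemy family short of `¬ABC`; with the five landed
FALSE corners `(8/3,0)`, `(2,1)`, `(1,3/2)`, `(0,2)` (and the conjectural boundary `θ + φ = 2` of the random
model in between) this is the complete proved picture of the plane. -/
theorem ubq₂_of_abc (habc : ABC) {θ φ : ℝ} (hθ : 0 ≤ θ) (hline : 9 / 4 * θ + φ < 2) :
    ∃ Z₀ : ℕ, ∀ v w Y Z : ℕ, Z₀ ≤ Z → 0 < v → 0 < w → 0 < Y → Nat.Coprime (v * Y) (w * Z) →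
      ((max v w : ℕ) : ℝ) ≤ (Z : ℝ) ^ θ → w * Z ^ 4 ≠ v * Y ^ 4 →
      (Z : ℝ) ^ φ < |((w * Z ^ 4 : ℕ) : ℝ) - ((v * Y ^ 4 : ℕ) : ℝ)| := by
  set s : ℝ := 2 - 9 / 4 * θ - φ with hsdef
  have hs : 0 < s := by rw [hsdef]; linarith
  set δ : ℝ := s / 16 with hδ
  have hδ0 : 0 < δ := by rw [hδ]; linarith
  obtain ⟨K, hK, hKabc⟩ := (ABC_iff.mp habc) δ hδ0
  -- threshold: K^4 2^{1+δ} Z^{16-3s} ≤ Z^16 for Z ≥ N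
  obtain ⟨N, hN⟩ := eventually_const_mul_rpow_le (K ^ (4:ℕ) * (2:ℝ) ^ (1 + δ)) (16 - 3 * s) 16 (by linarith)
  refine ⟨max N 1, fun v w Y Z hZ hv hw hY hcop hmax hne => ?_⟩
  have hZ1 : 1 ≤ Z := le_trans (le_max_right _ _) hZ
  have hZN : N ≤ Z := le_trans (le_max_left _ _) hZ
  have hZR : (1:ℝ) ≤ (Z:ℝ) := by exact_mod_cast hZ1
  have hZR0 : (0:ℝ) < (Z:ℝ) := by linarith
  have hvθ : (v:ℝ) ≤ (Z:ℝ) ^ θ := le_trans (by exact_mod_cast le_max_left v w) hmax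
  have hwθ : (w:ℝ) ≤ (Z:ℝ) ^ θ := le_trans (by exact_mod_cast le_max_right v w) hmax
  have hφ2 : φ < 2 := by nlinarith
  -- a := |wZ⁴ − vY⁴|; suppose a ≤ Z^φ and derive a contradiction
  by_contra hnot
  push Not at hnot
  have hcop4 : Nat.Coprime (v * Y ^ 4) (w * Z ^ 4) := coprime_binomial hcop
  -- Y-bound: Y⁴ ≤ 2 Z^{θ+4} in both cases, from vY⁴ ≤ wZ⁴ + a, a ≤ Z^φ ≤ Z^{θ+4}
  have hZθ4 : (Z:ℝ) ^ (4:ℕ) * (Z:ℝ) ^ θ = (Z:ℝ) ^ (θ + 4) := by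
    rw [← Real.rpow_natCast, ← Real.rpow_add hZR0]; norm_num; ring_nf
  have hwZ4 : ((w * Z ^ 4 : ℕ) : ℝ) ≤ (Z:ℝ) ^ (θ + 4) := by
    push_cast
    calc (w:ℝ) * (Z:ℝ) ^ 4 ≤ (Z:ℝ) ^ θ * (Z:ℝ) ^ 4 := by gcongr
      _ = (Z:ℝ) ^ (θ + 4) := by rw [mul_comm]; exact hZθ4
  have hφθ : (Z:ℝ) ^ φ ≤ (Z:ℝ) ^ (θ + 4) := Real.rpow_le_rpow_of_exponent_le hZR (by linarith)
  rcases lt_or_gt_of_ne hne with hlt | hgt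
  · -- case wZ⁴ < vY⁴ : triple (wZ⁴) + a = vY⁴, c = vY⁴
    set a : ℕ := v * Y ^ 4 - w * Z ^ 4 with ha
    have ha0 : 0 < a := Nat.sub_pos_of_lt hlt
    have hsum : w * Z ^ 4 + a = v * Y ^ 4 := by rw [ha]; omega
    have hle' : ((w * Z ^ 4 : ℕ) : ℝ) ≤ ((v * Y ^ 4 : ℕ) : ℝ) := by exact_mod_cast hlt.le
    have habs : |((w * Z ^ 4 : ℕ) : ℝ) - ((v * Y ^ 4 : ℕ) : ℝ)| = (a : ℝ) := by
      rw [abs_sub_comm, abs_of_nonneg (sub_nonneg.mpr hle'), ha, Nat.cast_sub hlt.le]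
    rw [habs] at hnot
    have hcopa : Nat.Coprime (w * Z ^ 4) a := by
      rw [ha, Nat.coprime_sub_self_right hlt.le]; exact hcop4.symm
    have htriple : IsABCTriple (w * Z ^ 4) a (v * Y ^ 4) :=
      ⟨Nat.mul_pos hw (pow_pos (by omega) 4), ha0, hsum, hcopa⟩
    have hKlt := hKabc _ _ _ htriple
    -- radical bound
    have hprodpos : 0 < a * (v * Y) * (w * Z) :=
      Nat.mul_pos (Nat.mul_pos ha0 (Nat.mul_pos hv hY)) (Nat.mul_pos hw (by omega))
    have hrad_dvd : rad (w * Z ^ 4) a (v * Y ^ 4) ∣ a * (v * Y) * (w * Z) := by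
      have h := rad_binomial_dvd a v w Y Z
      rw [rad_def] at h ⊢
      rwa [show w * Z ^ 4 * a * (v * Y ^ 4) = a * (v * Y ^ 4) * (w * Z ^ 4) by ring]
    have hRle : ((rad (w * Z ^ 4) a (v * Y ^ 4) : ℕ) : ℝ) ≤ (a:ℝ) * v * w * Y * Z := by
      have := Nat.le_of_dvd hprodpos hrad_dvd
      have h' : ((rad (w * Z ^ 4) a (v * Y ^ 4) : ℕ) : ℝ) ≤ ((a * (v * Y) * (w * Z) : ℕ) : ℝ) := by
        exact_mod_cast this
      push_cast at h'; linarith [h', show (a:ℝ) * (v * Y) * (w * Z) = (a:ℝ) * v * w * Y * Z by ring]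
    have hY4 : (Y:ℝ) ^ (4:ℕ) ≤ 2 * (Z:ℝ) ^ (θ + 4) := by
      have h1 : ((v * Y ^ 4 : ℕ) : ℝ) = ((w * Z ^ 4 : ℕ) : ℝ) + (a : ℝ) := by exact_mod_cast hsum.symm
      have hv1 : (1:ℝ) ≤ (v:ℝ) := by exact_mod_cast hv
      have hY4v : (Y:ℝ) ^ (4:ℕ) ≤ ((v * Y ^ 4 : ℕ) : ℝ) := by
        push_cast; nlinarith [pow_nonneg (show (0:ℝ) ≤ Y by positivity) 4]
      linarith [hY4v, h1, hwZ4, hnot, hφθ]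
    have hc : (Z:ℝ) ^ (4:ℕ) ≤ ((v * Y ^ 4 : ℕ) : ℝ) := by
      have : ((w * Z ^ 4 : ℕ) : ℝ) ≤ ((v * Y ^ 4 : ℕ) : ℝ) := by exact_mod_cast hlt.le
      have hw1 : (1:ℝ) ≤ (w:ℝ) := by exact_mod_cast hw
      push_cast at this ⊢; nlinarith [pow_nonneg hZR0.le 4]
    have key := abc_enemy_numerics hK hs hδ hsdef hZR (by positivity) (by positivity) (by positivity)
      (by positivity) hRle hc hKlt hnot hvθ hwθ hY4
    exact absurd (lt_of_lt_of_le key (hN Z hZN)) (lt_irrefl _)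
  · -- case vY⁴ < wZ⁴ : triple a + vY⁴ = wZ⁴ (as (vY⁴) + a = wZ⁴), c = wZ⁴
    set a : ℕ := w * Z ^ 4 - v * Y ^ 4 with ha
    have ha0 : 0 < a := Nat.sub_pos_of_lt hgt
    have hsum : v * Y ^ 4 + a = w * Z ^ 4 := by rw [ha]; omega
    have hle' : ((v * Y ^ 4 : ℕ) : ℝ) ≤ ((w * Z ^ 4 : ℕ) : ℝ) := by exact_mod_cast hgt.le
    have habs : |((w * Z ^ 4 : ℕ) : ℝ) - ((v * Y ^ 4 : ℕ) : ℝ)| = (a : ℝ) := by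
      rw [abs_of_nonneg (sub_nonneg.mpr hle'), ha, Nat.cast_sub hgt.le]
    rw [habs] at hnot
    have hcopa : Nat.Coprime (v * Y ^ 4) a := by
      rw [ha, Nat.coprime_sub_self_right hgt.le]; exact hcop4
    have htriple : IsABCTriple (v * Y ^ 4) a (w * Z ^ 4) :=
      ⟨Nat.mul_pos hv (pow_pos hY 4), ha0, hsum, hcopa⟩
    have hKlt := hKabc _ _ _ htriple
    have hprodpos : 0 < a * (v * Y) * (w * Z) :=
      Nat.mul_pos (Nat.mul_pos ha0 (Nat.mul_pos hv hY)) (Nat.mul_pos hw (by omega))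
    have hrad_dvd : rad (v * Y ^ 4) a (w * Z ^ 4) ∣ a * (v * Y) * (w * Z) := rad_binomial_dvd' a v w Y Z
    have hRle : ((rad (v * Y ^ 4) a (w * Z ^ 4) : ℕ) : ℝ) ≤ (a:ℝ) * v * w * Y * Z := by
      have := Nat.le_of_dvd hprodpos hrad_dvd
      have h' : ((rad (v * Y ^ 4) a (w * Z ^ 4) : ℕ) : ℝ) ≤ ((a * (v * Y) * (w * Z) : ℕ) : ℝ) := by
        exact_mod_cast this
      push_cast at h'; linarith [h', show (a:ℝ) * (v * Y) * (w * Z) = (a:ℝ) * v * w * Y * Z by ring]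
    have hY4 : (Y:ℝ) ^ (4:ℕ) ≤ 2 * (Z:ℝ) ^ (θ + 4) := by
      have h1 : ((v * Y ^ 4 : ℕ) : ℝ) ≤ ((w * Z ^ 4 : ℕ) : ℝ) := by exact_mod_cast hgt.le
      have hv1 : (1:ℝ) ≤ (v:ℝ) := by exact_mod_cast hv
      have hY4v : (Y:ℝ) ^ (4:ℕ) ≤ ((v * Y ^ 4 : ℕ) : ℝ) := by
        push_cast; nlinarith [pow_nonneg (show (0:ℝ) ≤ Y by positivity) 4]
      have h0 : (0:ℝ) ≤ (Z:ℝ) ^ (θ + 4) := by positivity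
      linarith [hY4v, h1, hwZ4]
    have hc : (Z:ℝ) ^ (4:ℕ) ≤ ((w * Z ^ 4 : ℕ) : ℝ) := by
      have hw1 : (1:ℝ) ≤ (w:ℝ) := by exact_mod_cast hw
      push_cast; nlinarith [pow_nonneg hZR0.le 4]
    have key := abc_enemy_numerics hK hs hδ hsdef hZR (by positivity) (by positivity) (by positivity)
      (by positivity) hRle hc hKlt hnot hvθ hwθ hY4
    exact absurd (lt_of_lt_of_le key (hN Z hZN)) (lt_irrefl _)


/-- **Diagonal case**: `ABC ⟹ UBQ η` for every `0 ≤ η < 8/13` (the matrix of the landed `stub_transfer`,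
p86153; previously only in the skeleton of the dead line `fourth-radical-binomial-thue`). -/
theorem ubq_of_abc (habc : ABC) {η : ℝ} (hη0 : 0 ≤ η) (hη : η < 8 / 13) :
    ∃ Z₀ : ℕ, ∀ v w Y Z : ℕ, Z₀ ≤ Z → 0 < v → 0 < w → 0 < Y → Nat.Coprime (v * Y) (w * Z) →
      ((max v w : ℕ) : ℝ) ≤ (Z : ℝ) ^ η → w * Z ^ 4 ≠ v * Y ^ 4 →
      (Z : ℝ) ^ η < |((w * Z ^ 4 : ℕ) : ℝ) - ((v * Y ^ 4 : ℕ) : ℝ)| :=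
  ubq₂_of_abc habc hη0 (by linarith)

/-! ## The strategist's moving-target ladder `S⁺3 ⟹ S⁺2 ⟹ UBQ ⟹ crux` is sandwiched under `ABC`

`Cruxes/TowerFourSubLiouville/StrategistSketch.lean` (planner-cstrat-stmt-ABC-1649-p1-0, 2026-08-17) types two rungs
above the crux-equivalent core and proves the downward edges `UniformMovingRoth4 ⟹ UniformMovingThue4 ⟹ crux`:

* `UniformMovingThue4` (S⁺2): `∀ ε ∈ (0,1) ∃ η > 0 ∃ Z₀ …  max(v,w) ≤ Z^η ⟹ |wZ⁴ − vY⁴| > Z^{1−ε}`;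
* `UniformMovingRoth4` (S⁺3): the same with saving `Z^{2−ε}` (Vojta for `(ℙ¹ × ℙ¹, D₍₁,₄₎)` in the wedge `h₁ ≤ η h₂`).

Both matrices are restated VERBATIM below.  The upward edges from `ABC` close the sandwich: no rung of the ladder is
refutable short of `¬ABC`, and `ABC` supplies the budgets `η(ε) = ε/5` (Roth rung; any `η < 4ε/9` works) and
`η(ε) = (1+ε)/3` (Thue rung; any `η < 4(1+ε)/9`), against the random-model thresholds `η < ε` resp. `η < 1 + ε`. -/

/-- **`ABC ⟹ UniformMovingRoth4`** (matrix of `StrategistSketch.UniformMovingRoth4` verbatim), with `η(ε) = ε/5`. -/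
theorem uniformMovingRoth4_of_abc (habc : ABC) :
    ∀ ε : ℝ, 0 < ε → ε < 1 → ∃ η : ℝ, 0 < η ∧ ∃ Z₀ : ℕ, ∀ v w Y Z : ℕ, Z₀ ≤ Z → 0 < v → 0 < w → 0 < Y →
      Nat.Coprime (v * Y) (w * Z) → ((max v w : ℕ) : ℝ) ≤ (Z : ℝ) ^ η → w * Z ^ 4 ≠ v * Y ^ 4 →
      (Z : ℝ) ^ (2 - ε) < |((w * Z ^ 4 : ℕ) : ℝ) - ((v * Y ^ 4 : ℕ) : ℝ)| := by
  intro ε hε _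
  exact ⟨ε / 5, by linarith, ubq₂_of_abc habc (by linarith) (by linarith)⟩

/-- **`ABC ⟹ UniformMovingThue4`** (matrix of `StrategistSketch.UniformMovingThue4` verbatim), with `η(ε) = (1+ε)/3`. -/
theorem uniformMovingThue4_of_abc (habc : ABC) :
    ∀ ε : ℝ, 0 < ε → ε < 1 → ∃ η : ℝ, 0 < η ∧ ∃ Z₀ : ℕ, ∀ v w Y Z : ℕ, Z₀ ≤ Z → 0 < v → 0 < w → 0 < Y →
      Nat.Coprime (v * Y) (w * Z) → ((max v w : ℕ) : ℝ) ≤ (Z : ℝ) ^ η → w * Z ^ 4 ≠ v * Y ^ 4 →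
      (Z : ℝ) ^ (1 - ε) < |((w * Z ^ 4 : ℕ) : ℝ) - ((v * Y ^ 4 : ℕ) : ℝ)| := by
  intro ε hε _
  exact ⟨(1 + ε) / 3, by linarith, ubq₂_of_abc habc (by linarith) (by linarith)⟩

/-! ## Unconditional calibration of the ladder: the budgets `η(ε)` are BOUNDED (landed false corners)

The `∃ η` of each rung cannot be strengthened to `∀ η`, and quantitatively: a Roth-rung witness at `ε < 1/2` has
`η ≤ 1` (corner `(1, 3/2)`, `padeFamily₂`), at any `ε < 1` has `η ≤ 2` (corner `(2,1)`, `padeFamily₁`); a Thue-rung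
witness has `η ≤ 8/3` at every `ε ≤ 1` (torus corner `(8/3, 0)`, trident–Pell); and the Roth rung with `ε < 0`
(saving beyond `Z²`) fails for EVERY `η > 0` (corner `(0,2)`, Dirichlet on two fixed forms) — the restriction
`0 < ε` is load-bearing.  Between these ceilings and the `ABC` floors `4ε/9`, `4(1+ε)/9` nothing is proved. -/

/-- Roth rung: at `ε < 1/2` no budget `η > 1` is possible. -/
theorem movingRoth4_budget_le_one {ε η : ℝ} (hε : ε < 1 / 2) (hη : 1 < η) :
    ¬ ∃ Z₀ : ℕ, ∀ v w Y Z : ℕ, Z₀ ≤ Z → 0 < v → 0 < w → 0 < Y → Nat.Coprime (v * Y) (w * Z) →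
      ((max v w : ℕ) : ℝ) ≤ (Z : ℝ) ^ η → w * Z ^ 4 ≠ v * Y ^ 4 →
      (Z : ℝ) ^ (2 - ε) < |((w * Z ^ 4 : ℕ) : ℝ) - ((v * Y ^ 4 : ℕ) : ℝ)| :=
  ubq₂_false_of_corner₅ (Or.inr (Or.inr (Or.inl ⟨hη, by linarith⟩)))

/-- Roth rung: at any `ε < 1` no budget `η > 2` is possible. -/
theorem movingRoth4_budget_le_two {ε η : ℝ} (hε : ε < 1) (hη : 2 < η) :
    ¬ ∃ Z₀ : ℕ, ∀ v w Y Z : ℕ, Z₀ ≤ Z → 0 < v → 0 < w → 0 < Y → Nat.Coprime (v * Y) (w * Z) →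
      ((max v w : ℕ) : ℝ) ≤ (Z : ℝ) ^ η → w * Z ^ 4 ≠ v * Y ^ 4 →
      (Z : ℝ) ^ (2 - ε) < |((w * Z ^ 4 : ℕ) : ℝ) - ((v * Y ^ 4 : ℕ) : ℝ)| :=
  ubq₂_false_of_corner₅ (Or.inr (Or.inl ⟨hη, by linarith⟩))

/-- Roth rung WITHOUT `0 < ε`: a saving beyond `Z²` fails for every budget `η > 0`. -/
theorem movingRoth4_false_without_pos_eps {ε η : ℝ} (hε : ε < 0) (hη : 0 < η) :
    ¬ ∃ Z₀ : ℕ, ∀ v w Y Z : ℕ, Z₀ ≤ Z → 0 < v → 0 < w → 0 < Y → Nat.Coprime (v * Y) (w * Z) →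
      ((max v w : ℕ) : ℝ) ≤ (Z : ℝ) ^ η → w * Z ^ 4 ≠ v * Y ^ 4 →
      (Z : ℝ) ^ (2 - ε) < |((w * Z ^ 4 : ℕ) : ℝ) - ((v * Y ^ 4 : ℕ) : ℝ)| :=
  ubq₂_false_of_corner₅ (Or.inr (Or.inr (Or.inr ⟨hη, by linarith⟩)))

/-- Thue rung: at any `ε ≤ 1` no budget `η > 8/3` is possible. -/
theorem movingThue4_budget_le {ε η : ℝ} (hε : ε ≤ 1) (hη : 8 / 3 < η) :
    ¬ ∃ Z₀ : ℕ, ∀ v w Y Z : ℕ, Z₀ ≤ Z → 0 < v → 0 < w → 0 < Y → Nat.Coprime (v * Y) (w * Z) →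
      ((max v w : ℕ) : ℝ) ≤ (Z : ℝ) ^ η → w * Z ^ 4 ≠ v * Y ^ 4 →
      (Z : ℝ) ^ (1 - ε) < |((w * Z ^ 4 : ℕ) : ℝ) - ((v * Y ^ 4 : ℕ) : ℝ)| :=
  ubq₂_false_of_corner₅ (Or.inl ⟨hη, by linarith⟩)

/-- The ladder's quantifier shape is load-bearing: `UniformMovingRoth4` with `∀ η` in place of `∃ η` is FALSE
(take `ε = 1/4`, `η = 3/2`), although each instance `ε` is `ABC`-true for small `η`. -/
theorem not_uniformMovingRoth4_forall_eta :
    ¬ ∀ ε : ℝ, 0 < ε → ε < 1 → ∀ η : ℝ, 0 < η → ∃ Z₀ : ℕ, ∀ v w Y Z : ℕ, Z₀ ≤ Z → 0 < v → 0 < w → 0 < Y →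
      Nat.Coprime (v * Y) (w * Z) → ((max v w : ℕ) : ℝ) ≤ (Z : ℝ) ^ η → w * Z ^ 4 ≠ v * Y ^ 4 →
      (Z : ℝ) ^ (2 - ε) < |((w * Z ^ 4 : ℕ) : ℝ) - ((v * Y ^ 4 : ℕ) : ℝ)| := fun h =>
  movingRoth4_budget_le_one (ε := 1 / 4) (η := 3 / 2) (by norm_num) (by norm_num)
    (h (1 / 4) (by norm_num) (by norm_num) (3 / 2) (by norm_num))

/-- Likewise for the Thue rung (`ε = 1/2`, `η = 3`). -/
theorem not_uniformMovingThue4_forall_eta :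
    ¬ ∀ ε : ℝ, 0 < ε → ε < 1 → ∀ η : ℝ, 0 < η → ∃ Z₀ : ℕ, ∀ v w Y Z : ℕ, Z₀ ≤ Z → 0 < v → 0 < w → 0 < Y →
      Nat.Coprime (v * Y) (w * Z) → ((max v w : ℕ) : ℝ) ≤ (Z : ℝ) ^ η → w * Z ^ 4 ≠ v * Y ^ 4 →
      (Z : ℝ) ^ (1 - ε) < |((w * Z ^ 4 : ℕ) : ℝ) - ((v * Y ^ 4 : ℕ) : ℝ)| := fun h =>
  movingThue4_budget_le (ε := 1 / 2) (η := 3) (by norm_num) (by norm_num)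
    (h (1 / 2) (by norm_num) (by norm_num) 3 (by norm_num))


end Summit.ABC.ABC.Theorems.TowerFourSubLiouville.Negative
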